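import Literature.Analysis.FunctionSpaces.ContDiffHolderFDerivCLM
import Literature.Analysis.FunctionSpaces.ContDiffHolderLocalization
import HarnessLib
-- buildfix (bf1-g32) B32-2: comment-only touch to re-dispatch the lane build (prune victim: source unchanged since 08-16, hub olean removed 22:46Z 08-28; head of the ContDiffHolderNormTwo → SchauderInteriorBall(Holder) chain reported stale:unbuilt by ns-idea-4 06:01Z); declarations byte-identical

/-!
# Localized second-order operators with smooth coefficients on `C^{k,r}_b` (Hölder spaces, part 13)

Topic `Literature/Analysis/FunctionSpaces`. A linear second-order differential operator
`P u = aⁱʲ ∂ᵢ∂ⱼ u + bˡ ∂ₗ u + c u` whose coefficients are `C^∞` on an open set `U ⊆ E`, localized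
by a `C^∞` cutoff `η` with compact support in `U`, is a bounded operator
`ηP : C^{k+2,r}_b(E, ℝ) →L[ℝ] C^{k,r}_b(E, ℝ)` (`0 ≤ r ≤ 1`; Gilbarg–Trudinger 2001, §6.1:
"`L` maps `C^{2,α}` boundedly into `C^{α}` when the coefficients are in `C^{α}`"). This is the
shape of every chart representative of a geometric operator (`□_g`, `Hess_g(∂ᵢ, ∂ⱼ)`,
Gilbarg–Trudinger (6.2); tree: `Literature/Geometry/Lorentzian/ChartLaplacian.lean`,
`Literature/Analysis/Calculus/CoordinateLaplacian.lean`), assembled from the jet operators of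
part 12 (`fderiv₂ApplyCLM`, `fderivApplyCLM`), the order-reduction inclusions
(`inclCLM : C^{k+1,r}_b →L C^{k,r}_b`) and multiplication by smooth compactly supported
coefficients (`coeffCLM`, parts 5 and 10).

* `ContDiffHolderFunction.inclCLM` — `C^{k+1,r}_b ⊆ C^{k,r}_b` as a bounded operator;
* `ContDiffHolderFunction.coeffCLM` — `u ↦ a·u` for `a ∈ C^∞_c(E)`;
* `ContDiffHolderFunction.localizedOperatorCLM` and its pointwise formula
  `localizedOperatorCLM_apply`.

Everything is proved; no named facts. Spaces in universe `0` (parts 5, 10). Brick (1d-ii-a) of the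
census of `Literature.Geometry.Riemannian.gurskyViaclovsky_pathOpen_weighted_four`.

## References

* D. Gilbarg, N. S. Trudinger, *Elliptic Partial Differential Equations of Second Order* (2001),
  §6.1, (6.1)–(6.2). [GilbargTrudinger2001]
-/

noncomputable section

open Set Filter Topology Function
open scoped NNReal ContDiff

namespace Literature.Analysis.FunctionSpaces

namespace ContDiffHolderFunction

/-! ### Order reduction as a bounded operator -/

section Incl

variable {E F : Type*} [NormedAddCommGroup E] [NormedSpace ℝ E] [NormedAddCommGroup F]
  [NormedSpace ℝ F] [CompleteSpace F] {k : ℕ} {r : ℝ≥0}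

/-- The inclusion `C^{k+1,r}_b ⊆ C^{k,r}_b` as a linear map (`r ≤ 1`). [folklore] -/
def inclₗ (hr : r ≤ 1) : ContDiffHolderFunction E F (k + 1) r →ₗ[ℝ] ContDiffHolderFunction E F k r where
  toFun u := ⟨u, u.memContDiffHolder.of_succ hr⟩
  map_add' _ _ := ContDiffHolderFunction.ext fun _ => rfl
  map_smul' _ _ := ContDiffHolderFunction.ext fun _ => rfl

/-- **The inclusion `C^{k+1,r}_b →L[ℝ] C^{k,r}_b`** (bounded; `‖u‖_{k,r} ≤ 3‖u‖_{k+1,r}`, here by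
the closed graph theorem). [folklore] -/
def inclCLM (hr : r ≤ 1) : ContDiffHolderFunction E F (k + 1) r →L[ℝ] ContDiffHolderFunction E F k r :=
  clmOfContinuousEval (inclₗ hr) fun x =>
    (evalCLM (E := E) (F := F) (k := k + 1) (r := r) x).continuous

/-- Pointwise: `inclCLM hr u x = u x`. [folklore] -/
@[simp]
theorem inclCLM_apply (hr : r ≤ 1) (u : ContDiffHolderFunction E F (k + 1) r) (x : E) :
    inclCLM hr u x = u x := rfl

/-- The underlying function of `inclCLM hr u` is that of `u`. [folklore] -/
@[simp]
theorem coe_inclCLM (hr : r ≤ 1) (u : ContDiffHolderFunction E F (k + 1) r) :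
    ((inclCLM hr u : ContDiffHolderFunction E F k r) : E → F) = u := rfl

/-- The double inclusion `C^{k+2,r}_b →L[ℝ] C^{k,r}_b`. [folklore] -/
def incl₂CLM (hr : r ≤ 1) : ContDiffHolderFunction E F (k + 2) r →L[ℝ] ContDiffHolderFunction E F k r :=
  (inclCLM (k := k) hr).comp (inclCLM (k := k + 1) hr)

/-- Pointwise: `incl₂CLM hr u x = u x`. [folklore] -/
@[simp]
theorem incl₂CLM_apply (hr : r ≤ 1) (u : ContDiffHolderFunction E F (k + 2) r) (x : E) :
    incl₂CLM hr u x = u x := rfl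

/-- The underlying function of `incl₂CLM hr u` is that of `u`. [folklore] -/
@[simp]
theorem coe_incl₂CLM (hr : r ≤ 1) (u : ContDiffHolderFunction E F (k + 2) r) :
    ((incl₂CLM hr u : ContDiffHolderFunction E F k r) : E → F) = u := rfl

end Incl

/-! ### Smooth compactly supported coefficients -/

section Coeff

variable {E F : Type} [NormedAddCommGroup E] [NormedSpace ℝ E] [NormedAddCommGroup F]
  [NormedSpace ℝ F] {k : ℕ} {r : ℝ≥0}

/-- A `C^∞` compactly supported function as an element of `C^{k,r}_b(E, ℝ)` (`r ≤ 1`). [folklore] -/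
def ofSmoothCompactSupport (hr : r ≤ 1) (a : E → ℝ) (ha : ContDiff ℝ ∞ a)
    (has : HasCompactSupport a) : ContDiffHolderFunction E ℝ k r :=
  ⟨a, MemContDiffHolder.of_contDiff_of_hasCompactSupport ha has hr⟩

/-- Pointwise: `ofSmoothCompactSupport hr a ha has x = a x`. [folklore] -/
@[simp]
theorem ofSmoothCompactSupport_apply (hr : r ≤ 1) (a : E → ℝ) (ha : ContDiff ℝ ∞ a)
    (has : HasCompactSupport a) (x : E) : ofSmoothCompactSupport (k := k) hr a ha has x = a x := rfl

/-- **Multiplication by a smooth compactly supported coefficient** as a bounded operator on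
`C^{k,r}_b(E, F)`. [folklore] -/
def coeffCLM (hr : r ≤ 1) (a : E → ℝ) (ha : ContDiff ℝ ∞ a) (has : HasCompactSupport a) :
    ContDiffHolderFunction E F k r →L[ℝ] ContDiffHolderFunction E F k r :=
  bilinearCLM hr (ContinuousLinearMap.lsmul ℝ ℝ) (ofSmoothCompactSupport hr a ha has)

/-- Pointwise: `coeffCLM hr a ha has u x = a x • u x`. [folklore] -/
@[simp]
theorem coeffCLM_apply (hr : r ≤ 1) (a : E → ℝ) (ha : ContDiff ℝ ∞ a) (has : HasCompactSupport a)
    (u : ContDiffHolderFunction E F k r) (x : E) : coeffCLM hr a ha has u x = a x • u x := rfl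

/-- A coefficient `C^∞` on an open set times a cutoff with compact support inside it is a global
`C^∞` compactly supported function. [folklore] -/
theorem contDiff_cutoff_mul {η a : E → ℝ} (hη : ContDiff ℝ ∞ η) {U : Set E} (hU : IsOpen U)
    (ha : ContDiffOn ℝ ∞ a U) (hηU : tsupport η ⊆ U) : ContDiff ℝ ∞ fun y => η y * a y :=
  ContDiff.smul_of_contDiffOn hη hU ha hηU

omit [NormedSpace ℝ E] in
/-- The cutoff times a coefficient has compact support. [folklore] -/
theorem hasCompactSupport_cutoff_mul {η : E → ℝ} (hηs : HasCompactSupport η) (a : E → ℝ) :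
    HasCompactSupport fun y => η y * a y :=
  hηs.mul_right

end Coeff

/-! ### Localized second-order operators -/

section Operator

variable {E : Type} [NormedAddCommGroup E] [NormedSpace ℝ E] {k : ℕ} {r : ℝ≥0}
  {ι : Type*} [Fintype ι]

/-- **The localized operator** `u ↦ η · (∑ᵢⱼ aⁱʲ D²u(eᵢ,eⱼ) + ∑ₗ bˡ Du(eₗ) + c u)` as a bounded
operator `C^{k+2,r}_b(E, ℝ) →L[ℝ] C^{k,r}_b(E, ℝ)`, for coefficients `C^∞` on an open `U` and a
`C^∞` cutoff `η` with compact support in `U` (`r ≤ 1`). [cite: GilbargTrudinger2001, §6.1] -/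
def localizedOperatorCLM (hr : r ≤ 1) (η : E → ℝ) (hη : ContDiff ℝ ∞ η) (hηs : HasCompactSupport η)
    {U : Set E} (hU : IsOpen U) (hηU : tsupport η ⊆ U) (e : ι → E) (a : ι → ι → E → ℝ)
    (ha : ∀ i j, ContDiffOn ℝ ∞ (a i j) U) (b : ι → E → ℝ) (hb : ∀ l, ContDiffOn ℝ ∞ (b l) U)
    (c : E → ℝ) (hc : ContDiffOn ℝ ∞ c U) :
    ContDiffHolderFunction E ℝ (k + 2) r →L[ℝ] ContDiffHolderFunction E ℝ k r :=
  (∑ i, ∑ j, (coeffCLM hr (fun y => η y * a i j y) (contDiff_cutoff_mul hη hU (ha i j) hηU)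
      (hasCompactSupport_cutoff_mul hηs _)).comp (fderiv₂ApplyCLM (e i) (e j))) +
    (∑ l, (coeffCLM hr (fun y => η y * b l y) (contDiff_cutoff_mul hη hU (hb l) hηU)
      (hasCompactSupport_cutoff_mul hηs _)).comp ((fderivApplyCLM (e l)).comp (inclCLM hr))) +
    (coeffCLM hr (fun y => η y * c y) (contDiff_cutoff_mul hη hU hc hηU)
      (hasCompactSupport_cutoff_mul hηs _)).comp (incl₂CLM hr)

/-- Finite sums of elements of `C^{k,r}_b` evaluate pointwise. [folklore] -/
theorem coe_finset_sum {F : Type*} [NormedAddCommGroup F] [NormedSpace ℝ F] {α : Type*}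
    (s : Finset α) (f : α → ContDiffHolderFunction E F k r) (x : E) :
    (∑ a ∈ s, f a) x = ∑ a ∈ s, f a x := by
  classical
  induction s using Finset.induction_on with
  | empty => simp
  | insert a s ha ih => simp [Finset.sum_insert ha, ih]

/-- **Pointwise formula** for the localized operator:
`(ηP) u (y) = η y · (∑ᵢⱼ aⁱʲ(y) D²u(y)(eᵢ,eⱼ) + ∑ₗ bˡ(y) Du(y)(eₗ) + c(y) u(y))`. [folklore] -/
theorem localizedOperatorCLM_apply (hr : r ≤ 1) (η : E → ℝ) (hη : ContDiff ℝ ∞ η)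
    (hηs : HasCompactSupport η) {U : Set E} (hU : IsOpen U) (hηU : tsupport η ⊆ U) (e : ι → E)
    (a : ι → ι → E → ℝ) (ha : ∀ i j, ContDiffOn ℝ ∞ (a i j) U) (b : ι → E → ℝ)
    (hb : ∀ l, ContDiffOn ℝ ∞ (b l) U) (c : E → ℝ) (hc : ContDiffOn ℝ ∞ c U)
    (u : ContDiffHolderFunction E ℝ (k + 2) r) (y : E) :
    localizedOperatorCLM hr η hη hηs hU hηU e a ha b hb c hc u y =
      η y * ((∑ i, ∑ j, a i j y * fderiv ℝ (fderiv ℝ (u : E → ℝ)) y (e i) (e j)) +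
        (∑ l, b l y * fderiv ℝ (u : E → ℝ) y (e l)) + c y * u y) := by
  simp only [localizedOperatorCLM, add_apply, FunLike.coe_sum, Finset.sum_apply,
    ContinuousLinearMap.coe_comp, comp_apply, coe_add, Pi.add_apply, coe_finset_sum, coeffCLM_apply,
    fderiv₂ApplyCLM_apply, fderivApplyCLM_apply, coe_inclCLM, incl₂CLM_apply, smul_eq_mul]
  simp only [mul_add, Finset.mul_sum, mul_assoc]

end Operator

end ContDiffHolderFunction

end Literature.Analysis.FunctionSpaces

end
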